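import Summits.QuantumFields.YangMills.Theorems.AtomicSynthesisSlotSynthIteration

/-!
# AtomicSynthesis (stmt-QuantumFields-28126), stub `stub_singleSlot` — H5 (part 2): flattening the double series;
`OneStep ⇒ SlotSynth`; the reduction `OneStepExists N → StubSingleSlotP`

AUTHOR: planner ym-idea-11 g14 (HOME `g14/oneStepSplit.lean` §Flatten + §H5, sorry-free); landed by prover w4 g22 (`--supports 28126`;
also path α of 23138 / 22956), split at the 400-line cap.  The (round, atom) double series is absolutely summable, re-indexed over
`ℕ` via `Encodable`, giving `slotSynth_of_oneStep : OneStep b N θ C R → … → ∃ C₁ ≥ 0, SlotSynth b C₁ N` and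
`stubSingleSlot_of_oneStepExists : OneStepExists N → StubSingleSlotP` (the registered stub text of `RPOnsetFloorPosTimeSynthCollar`).
Elementary; no stub/crux/rung/summit is closed by this file; the YM mass gap is NOT proved. [folklore]
-/

set_option autoImplicit false

noncomputable section

open scoped BigOperators Topology ContDiff
open MeasureTheory Filter Metric
open Summit.QuantumFields.YangMills.Theorems.RPOnsetFloorPosTimeSynthCollar (SlotSynth)

namespace Summit.QuantumFields.YangMills.Cruxes.AtomicSynthesis.SingleSlotPlan

section Flatten

variable {b : SchwartzMap E4 ℝ} {N : ℕ} {θ C R : ℝ} {c : E4}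
variable (h : OneStep b N θ C R) (hθ : 0 < θ) (hθ1 : θ < 1) (hR : 0 ≤ R) (S₀ : Stage N c)

/-- Geometric mass bound of round `r`. -/
theorem mass_le_geom (r : ℕ) (hC : 0 ≤ C) :
    ∑ j, |(round h (stage h hθ hθ1.le hR S₀ r)).a j| ≤
      (C * ((S₀.ϱ + R * θ * S₀.σ / (1 - θ)) / (θ * S₀.σ)) ^ 4 * S₀.A) * θ ^ r := by
  have h2 := mass_le h hθ hθ1 hR S₀ r hC
  have h3 : C * ((S₀.ϱ + R * θ * S₀.σ / (1 - θ)) / (θ ^ (r + 1) * S₀.σ)) ^ 4 * (θ ^ (5 * r) * S₀.A) =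
      (C * ((S₀.ϱ + R * θ * S₀.σ / (1 - θ)) / (θ * S₀.σ)) ^ 4 * S₀.A) * θ ^ r := by
    have hθ0 : θ ≠ 0 := hθ.ne'
    have hσ0 : S₀.σ ≠ 0 := S₀.hσ.ne'
    field_simp
    ring
  rw [h3] at h2
  exact h2

/-- The index type of all atoms: (round, atom). -/
abbrev Idx : Type := Σ r : ℕ, Fin (round h (stage h hθ hθ1.le hR S₀ r)).J

/-- Coefficient, scale and centre of an atom. -/
def coefT (i : Idx h hθ hθ1 hR S₀) : ℝ := (round h (stage h hθ hθ1.le hR S₀ i.1)).a i.2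
/-- The scale of the atom with flattened index `i`. -/
def scaleT (i : Idx h hθ hθ1 hR S₀) : ℝ := θ * (stage h hθ hθ1.le hR S₀ i.1).σ
/-- The centre of the atom with flattened index `i`. -/
def centreT (i : Idx h hθ hθ1 hR S₀) : E4 := (round h (stage h hθ hθ1.le hR S₀ i.1)).η i.2

/-- The atom with flattened index `i`, written with `coefT`/`scaleT`/`centreT`. -/
theorem atom_eq (i : Idx h hθ hθ1 hR S₀) (z : E4) :
    coefT h hθ hθ1 hR S₀ i * b ((scaleT h hθ hθ1 hR S₀ i)⁻¹ • (z - centreT h hθ hθ1 hR S₀ i)) =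
      atom h hθ hθ1 hR S₀ i.1 i.2 z := rfl

/-- The coefficients are absolutely summable, with the geometric total bound. -/
theorem summable_abs_coefT (hC : 0 ≤ C) :
    Summable (fun i : Idx h hθ hθ1 hR S₀ => |coefT h hθ hθ1 hR S₀ i|) ∧
      ∑' i : Idx h hθ hθ1 hR S₀, |coefT h hθ hθ1 hR S₀ i| ≤
        (C * ((S₀.ϱ + R * θ * S₀.σ / (1 - θ)) / (θ * S₀.σ)) ^ 4 * S₀.A) / (1 - θ) := by
  set K := C * ((S₀.ϱ + R * θ * S₀.σ / (1 - θ)) / (θ * S₀.σ)) ^ 4 * S₀.A with hK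
  have hgeom : Summable fun r : ℕ => K * θ ^ r := (summable_geometric_of_lt_one hθ.le hθ1).mul_left K
  have hinner : ∀ r, Summable fun j : Fin (round h (stage h hθ hθ1.le hR S₀ r)).J =>
      |coefT h hθ hθ1 hR S₀ ⟨r, j⟩| := fun r => (hasSum_fintype _).summable
  have houter_le : ∀ r, ∑' j : Fin (round h (stage h hθ hθ1.le hR S₀ r)).J, |coefT h hθ hθ1 hR S₀ ⟨r, j⟩| ≤ K * θ ^ r := by
    intro r
    rw [tsum_fintype]
    exact mass_le_geom h hθ hθ1 hR S₀ r hC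
  have houter : Summable fun r => ∑' j : Fin (round h (stage h hθ hθ1.le hR S₀ r)).J, |coefT h hθ hθ1 hR S₀ ⟨r, j⟩| :=
    Summable.of_nonneg_of_le (fun r => tsum_nonneg fun j => abs_nonneg _) houter_le hgeom
  have hS : Summable (fun i : Idx h hθ hθ1 hR S₀ => |coefT h hθ hθ1 hR S₀ i|) :=
    (summable_sigma_of_nonneg (fun i => abs_nonneg _)).2 ⟨hinner, houter⟩
  refine ⟨hS, ?_⟩
  rw [hS.tsum_sigma' hinner]
  calc ∑' r, ∑' j : Fin (round h (stage h hθ hθ1.le hR S₀ r)).J, |coefT h hθ hθ1 hR S₀ ⟨r, j⟩|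
      ≤ ∑' r : ℕ, K * θ ^ r := Summable.tsum_le_tsum houter_le houter hgeom
    _ = K / (1 - θ) := by
        rw [tsum_mul_left, tsum_geometric_of_lt_one hθ.le hθ1]; ring

/-- Pointwise synthesis over the sigma index. -/
theorem hasSum_sigma (hC : 0 ≤ C) (z : E4) :
    Summable (fun i : Idx h hθ hθ1 hR S₀ => atom h hθ hθ1 hR S₀ i.1 i.2 z) ∧
      ∑' i : Idx h hθ hθ1 hR S₀, atom h hθ hθ1 hR S₀ i.1 i.2 z = S₀.f z := by
  obtain ⟨B, hBpos, hB⟩ := b.decay 0 0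
  have hB' : ∀ x, |b x| ≤ B := fun x => by simpa [norm_iteratedFDeriv_zero, Real.norm_eq_abs] using hB x
  have hS := (summable_abs_coefT h hθ hθ1 hR S₀ hC).1
  have hG : Summable (fun i : Idx h hθ hθ1 hR S₀ => atom h hθ hθ1 hR S₀ i.1 i.2 z) := by
    refine Summable.of_norm_bounded (g := fun i => |coefT h hθ hθ1 hR S₀ i| * B) (hS.mul_right B) fun i => ?_
    rw [Real.norm_eq_abs, ← atom_eq, abs_mul]
    exact mul_le_mul_of_nonneg_left (hB' _) (abs_nonneg _)
  refine ⟨hG, ?_⟩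
  rw [hG.tsum_sigma' (fun r => (hasSum_fintype _).summable)]
  simp_rw [tsum_fintype]
  exact (hasSum_rounds h hθ hθ1 hR S₀ hC z).tsum_eq

/-- Extension by a default value along the encoding of the (countable) index type into `ℕ`. -/
def ext {X : Type} (g : Idx h hθ hθ1 hR S₀ → X) (d : X) (n : ℕ) : X :=
  (Encodable.decode₂ (Idx h hθ hθ1 hR S₀) n).elim d g

/-- The `ℕ`-extension agrees with `g` at encoded indices. -/
theorem ext_encode {X : Type} (g : Idx h hθ hθ1 hR S₀ → X) (d : X) (i : Idx h hθ hθ1 hR S₀) :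
    ext h hθ hθ1 hR S₀ g d (Encodable.encode i) = g i := by
  simp [ext]

/-- Every value of the `ℕ`-extension is a value of `g` or the default. -/
theorem ext_cases {X : Type} (g : Idx h hθ hθ1 hR S₀ → X) (d : X) (n : ℕ) :
    ext h hθ hθ1 hR S₀ g d n = d ∨ ∃ i, Encodable.encode i = n ∧ ext h hθ hθ1 hR S₀ g d n = g i := by
  unfold ext
  cases hn : Encodable.decode₂ (Idx h hθ hθ1 hR S₀) n with
  | none => left; simp
  | some i => right; exact ⟨i, Encodable.decode₂_eq_some.1 hn, by simp⟩

/-- The support of the `ℕ`-extension lies in the range of the encoding. -/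
theorem support_ext_subset (g : Idx h hθ hθ1 hR S₀ → ℝ) :
    Function.support (ext h hθ hθ1 hR S₀ g 0) ⊆ Set.range (Encodable.encode : Idx h hθ hθ1 hR S₀ → ℕ) := by
  intro n hn
  rcases ext_cases h hθ hθ1 hR S₀ g 0 n with h0 | ⟨i, hi, -⟩
  · exact absurd h0 hn
  · exact ⟨i, hi⟩

/-- The sum of the `ℕ`-extension equals the sum of `g`. -/
theorem tsum_ext (g : Idx h hθ hθ1 hR S₀ → ℝ) :
    ∑' n, ext h hθ hθ1 hR S₀ g 0 n = ∑' i, g i := by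
  rw [← (Encodable.encode_injective).tsum_eq (support_ext_subset h hθ hθ1 hR S₀ g)]
  simp_rw [ext_encode]

/-- The `ℕ`-extension of a summable family is summable. -/
theorem summable_ext {g : Idx h hθ hθ1 hR S₀ → ℝ} (hg : Summable g) :
    Summable (ext h hθ hθ1 hR S₀ g 0) := by
  rw [← (Encodable.encode_injective).summable_iff (fun n hn => by
    by_contra hne
    exact hn (support_ext_subset h hθ hθ1 hR S₀ g (Function.mem_support.2 hne)))]
  have : (ext h hθ hθ1 hR S₀ g 0) ∘ Encodable.encode = g := funext fun i => ext_encode h hθ hθ1 hR S₀ g 0 i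
  rw [this]; exact hg

end Flatten

/-! ## H5: `OneStep ⇒ SlotSynth` -/

/-- **H5.** Iterating one round gives single-slot synthesis with `C₁ = C q⁴/(1−θ)`, `q = (3/2 + Rθs/(1−θ))/(θs)`,
`s = (1−θ)/(2(R+1))`. [folklore] -/
theorem slotSynth_of_oneStep (b : SchwartzMap E4 ℝ) (N : ℕ) (θ C R : ℝ) (hθ : 0 < θ) (hθ1 : θ < 1)
    (hC : 0 ≤ C) (hR : 0 ≤ R) (h : OneStep b N θ C R) :
    ∃ C₁ : ℝ, 0 ≤ C₁ ∧ SlotSynth b C₁ N := by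
  -- the initial relative scale
  set s : ℝ := (1 - θ) / (2 * (R + 1)) with hs
  have h1θ : 0 < 1 - θ := by linarith
  have hs0 : 0 < s := div_pos h1θ (by positivity)
  have hs1 : s ≤ 1 := by
    rw [hs, div_le_one (by positivity)]; nlinarith
  set q : ℝ := (3 / 2 + R * θ * s / (1 - θ)) / (θ * s) with hq
  refine ⟨C * q ^ 4 / (1 - θ), div_nonneg (mul_nonneg hC (pow_nonneg ?_ 4)) h1θ.le, ?_⟩
  · rw [hq]; positivity
  intro ψ c ρ M' hρ hsupp hbd
  set S₀ : Stage N c := stage₀ ψ c ρ M' s hρ hs0 hs1 hsupp hbd with hS₀def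
  have hS₀f : S₀.f = ψ := rfl
  have hS₀ϱ : S₀.ϱ = 3 / 2 * ρ := rfl
  have hS₀σ : S₀.σ = s * ρ := rfl
  have hS₀A : S₀.A = M' := rfl
  -- the key constant identity: `(P/(θσ₀)) = q` (ρ cancels)
  have hPq : (S₀.ϱ + R * θ * S₀.σ / (1 - θ)) / (θ * S₀.σ) = q := by
    rw [hS₀ϱ, hS₀σ, hq]
    have hρ0 : ρ ≠ 0 := hρ.ne'
    have hθ0 : θ ≠ 0 := hθ.ne'
    have hs0' : s ≠ 0 := hs0.ne'
    have h1 : (1 - θ) ≠ 0 := h1θ.ne'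
    field_simp
  -- `P ≤ 2ρ`
  have hP2 : S₀.ϱ + R * θ * S₀.σ / (1 - θ) ≤ 2 * ρ := by
    rw [hS₀ϱ, hS₀σ]
    have : R * θ * (s * ρ) / (1 - θ) ≤ ρ / 2 := by
      rw [div_le_iff₀ h1θ, hs]
      have hRθ : R * θ ≤ R + 1 := by nlinarith
      have : R * θ * ((1 - θ) / (2 * (R + 1)) * ρ) = (R * θ / (R + 1)) * ((1 - θ) * ρ) / 2 := by
        field_simp
      rw [this]
      have h3 : R * θ / (R + 1) ≤ 1 := by rw [div_le_one (by positivity)]; exact hRθ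
      nlinarith [mul_nonneg h1θ.le hρ.le]
    linarith
  -- witnesses
  refine ⟨ext h hθ hθ1 hR S₀ (coefT h hθ hθ1 hR S₀) 0, ext h hθ hθ1 hR S₀ (scaleT h hθ hθ1 hR S₀) ρ,
    ext h hθ hθ1 hR S₀ (centreT h hθ hθ1 hR S₀) c, ?_, ?_, ?_, ?_⟩
  -- (1) absolute summability of the coefficients
  · have habs : (fun n => |ext h hθ hθ1 hR S₀ (coefT h hθ hθ1 hR S₀) 0 n|) =
        ext h hθ hθ1 hR S₀ (fun i => |coefT h hθ hθ1 hR S₀ i|) 0 := by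
      funext n
      unfold ext
      cases Encodable.decode₂ (Idx h hθ hθ1 hR S₀) n <;> simp
    rw [habs]
    exact summable_ext h hθ hθ1 hR S₀ (summable_abs_coefT h hθ hθ1 hR S₀ hC).1
  -- (2) the mass bound
  · have habs : ∀ n, |ext h hθ hθ1 hR S₀ (coefT h hθ hθ1 hR S₀) 0 n| =
        ext h hθ hθ1 hR S₀ (fun i => |coefT h hθ hθ1 hR S₀ i|) 0 n := by
      intro n
      unfold ext
      cases Encodable.decode₂ (Idx h hθ hθ1 hR S₀) n <;> simp
    rw [tsum_congr habs, tsum_ext]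
    refine (summable_abs_coefT h hθ hθ1 hR S₀ hC).2.trans ?_
    rw [hPq, hS₀A]
    exact le_of_eq (by ring)
  -- (3) scales and centres
  · intro n
    unfold ext
    cases Encodable.decode₂ (Idx h hθ hθ1 hR S₀) n with
    | none => simp [hρ, hρ.le]
    | some i =>
      obtain ⟨r, j⟩ := i
      simp only [Option.elim_some, scaleT, centreT]
      have hσr : (stage h hθ hθ1.le hR S₀ r).σ = θ ^ r * (s * ρ) := by rw [stage_σ, hS₀σ]
      refine ⟨mul_pos hθ (stage h hθ hθ1.le hR S₀ r).hσ, ?_, ?_⟩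
      · rw [hσr]
        have h1 : θ * θ ^ r ≤ 1 := by
          rw [← pow_succ']; exact pow_le_one₀ hθ.le hθ1.le
        have h2 : θ * (θ ^ r * (s * ρ)) = (θ * θ ^ r) * s * ρ := by ring
        rw [h2]
        have h3 : (θ * θ ^ r) * s ≤ 1 := by
          calc (θ * θ ^ r) * s ≤ 1 * 1 := mul_le_mul h1 hs1 hs0.le zero_le_one
            _ = 1 := one_mul 1
        nlinarith
      · have hη := (round h (stage h hθ hθ1.le hR S₀ r)).hη j
        have hϱ := stage_ϱ_le h hθ hθ1 hR S₀ r
        linarith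
  -- (4) pointwise synthesis
  · intro z
    have hfun : ∀ n, ext h hθ hθ1 hR S₀ (coefT h hθ hθ1 hR S₀) 0 n *
        b ((ext h hθ hθ1 hR S₀ (scaleT h hθ hθ1 hR S₀) ρ n)⁻¹ • (z - ext h hθ hθ1 hR S₀ (centreT h hθ hθ1 hR S₀) c n)) =
        ext h hθ hθ1 hR S₀ (fun i => atom h hθ hθ1 hR S₀ i.1 i.2 z) 0 n := by
      intro n
      unfold ext
      cases Encodable.decode₂ (Idx h hθ hθ1 hR S₀) n with
      | none => simp
      | some i => simp only [Option.elim_some]; exact atom_eq h hθ hθ1 hR S₀ i z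
    rw [tsum_congr hfun, tsum_ext, (hasSum_sigma h hθ hθ1 hR S₀ hC z).2, hS₀f]


/-- The single remaining analytic input of the plan, as one Prop: one round exists for every admissible profile. -/
def OneStepExists (N : ℕ) : Prop :=
  ∀ b : SchwartzMap E4 ℝ, HasCompactSupport (b : E4 → ℝ) → (∫ y, b y) ≠ 0 →
    ∃ θ C R : ℝ, 0 < θ ∧ θ < 1 ∧ 0 ≤ C ∧ 0 ≤ R ∧ OneStep b N θ C R

/-- **Reduction of the registered stub.** `stub_singleSlot` (`StubSingleSlotP`) follows from `OneStepExists N` for any one `N`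
(the plan takes `N = 6`, where H1 `momentKilling b 6` — proved in `momentWeights.lean` — feeds the construction of the round). -/
theorem stubSingleSlot_of_oneStepExists (N : ℕ) (h : OneStepExists N) :
    Summit.QuantumFields.YangMills.Theorems.RPOnsetFloorPosTimeSynthCollar.StubSingleSlotP := by
  intro b hb hI
  obtain ⟨θ, C, R, hθ, hθ1, hC, hR, h1⟩ := h b hb hI
  obtain ⟨C₁, hC₁, hS⟩ := slotSynth_of_oneStep b N θ C R hθ hθ1 hC hR h1
  exact ⟨C₁, N, hC₁, hS⟩

end Summit.QuantumFields.YangMills.Cruxes.AtomicSynthesis.SingleSlotPlan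

end
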